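import Literature.Analysis.InnerProduct.HilbertComplexHarmonicCohomology
import HarnessLib

/-!
# Maps of Hilbert complexes and homotopy operators: the induced maps on the cohomology `Ker S / Im T`, on the
# reduced cohomology `Ker S / cl Im T` and on the harmonic space `𝔥 = Ker S ∩ Ker T*` are functorial, agree under
# the Hodge isomorphism, and homotopic maps induce the same maps (Brüning–Lesch 1992 §2, (2.7), Lemma 2.7,
# Definition 2.8, Lemma 2.9, Lemma 2.10)

Layer `Literature/Analysis/InnerProduct`, namespace `Literature.Analysis.InnerProduct`; sequel BY NAME of
`HilbertComplexHarmonicCohomology.lean` (`pmapKer_inf_orthogonal_harmonic_eq_closure_range` — `Ker S ∩ 𝔥^⊥ =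
cl Im T`, `bijective_mkQ_comp_inclusion_harmonic` — the Hodge isomorphism `𝔥 → Ker S → Ker S / cl Im T`) and
`ClosedDenselyDefinedHilbertComplex.lean` (`mem_pmapKer_iff`, `isOrtho_inf_closure_range`, `closure_range_le_ker`,
`orthogonal_range_eq_ker_adjoint`). The endomorphism case (one complex, `τ_E, τ_F, τ_G`) of §1–§2 is row g33-#5's
`apply_mem_pmapKer_of_chainMap` / `apply_mem_closure_range_of_chainMap` / `exists_cohomology_map`
(`HilbertComplexLefschetzHeatTrace.lean`); here the maps go between two (or three) different complexes, which is
what functoriality needs. Lane `lit-hodgefound` (Track 2 foundations library), prover seat `lit-hodgefound-p06`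
(generation 34), self-proposed row g34-#3. THEOREMS ONLY (no definition, no instance, no named fact). Unbounded
operators are Mathlib's `LinearPMap` (`T : E →ₗ.[𝕜] F`, adjoint `T†`); `Ker S` as a subspace of `F` is
`(LinearMap.ker S.toFun).map S.domain.subtype`, `Im T` is `LinearMap.range T.toFun`, the cohomology
`H¹ = Ker S / Im T` is the quotient of `↥(Ker S)` by `(Im T).comap (Ker S).subtype`, the reduced cohomology
`H̄¹ = Ker S / cl Im T` likewise with `(Im T).topologicalClosure`, and the harmonic space is `𝔥 = Ker S ⊓ Ker T*`.
Nothing is defined: a map of complexes is a triple of bounded maps `g_E, g_F, g_G` with the two hypotheses `hgT`,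
`hgS` below ((2.7a)–(2.7b)); "the induced map `g_*`" is any linear map `gq` between the quotients with
`gq [u] = [g_F u]` (it exists, `exists_cohomologyMap`, and is unique, `cohomologyMap_unique`); "the induced map
`ĝ`" is the bounded map `𝔥'.orthogonalProjectionOnto ∘ g_F ∘ 𝔥.subtypeL : 𝔥 → 𝔥'`; a homotopy operator is a pair
of linear maps `A_F : F → E'`, `A_G : G → F'` with the hypothesis `hhom` ((2.27)).

## Source, verbatim

J. Brüning, M. Lesch, *Hilbert complexes*, J. Funct. Anal. 108 (1992), §2 pp. 90, 95–97 (held text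
`paper:doi-10-1016-0022-1236-92-90147-b`, p0003, p0008–p0010):

"Maps are defined in the obvious way: if `(𝒟, D)` and `(𝒟′, D′)` are Hilbert complexes and `g_i : H_i → H′_i`
is a bounded linear map for each `i` with `g_i(𝒟_i) ⊂ 𝒟′_i` (2.7a), `D′_i ∘ g_i = g_{i+1} ∘ D_i` (2.7b), then
`g := ⊕ g_i : (𝒟, D) → (𝒟′, D′)` is called a map of Hilbert complexes. The induced map on homology will be denoted
by `g_*`. … LEMMA 2.7. Let `g : (𝒟, D) → (𝒟′, D′)` be a map of Hilbert complexes, and denote by `P_i^{(1)}`,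
`P_i^{(2)}` the orthogonal projections in `H′_i` onto `𝓗̂′_i` and `s(Δ′^{(2)}) ∩ H′_i`, `j = 1, 2`. Then `g` induces
functorial homomorphisms for all `i`, `ĝ_i := P_i^{(1)} ∘ g_i : 𝓗̂_i → 𝓗̂′_i`, `g_i^j := P_i^{(j)} ∘ g_i :
s(Δ^{(j)}) ∩ H_i → s(Δ′^{(j)}) ∩ H′_i`. If `g_i` is unitary then so are `g_{i*}`, `ĝ_i`, and `g_i^j`. Proof. The
assertion concerning `g_{i*}` is obvious from the definition. For the functoriality of `ĝ_i` we have to show that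
with `h : (𝒟′, D′) → (𝒟″, D″)` a second complex map it follows that `ĥ_i ∘ ĝ_i = (h ∘ g)^_i`. But this is an easy
consequence of the fact that `g_i` maps `ker D_i` to `ker D′_i` and `cl ℛ_{i−1} = s(Δ_i^1)` to `cl ℛ′_{i−1}`.
Finally, if `g_i` is unitary it respects orthogonality, and `g_i(𝓗̂_i) = 𝓗̂′_i`. The proof for `g_i^j` is very
similar. … DEFINITION 2.8. Let `g, h : (𝒟, D) → (𝒟′, D′)` be maps of Hilbert complexes. A homotopy operator for
`g` and `h` is a collection of linear maps, `A_i`, `A_i : 𝒟_i → 𝒟′_{i−1}` (2.26), such that on `𝒟_i`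
`g_i − h_i = D′_{i−1} A_i + A_{i+1} D_i` (2.27). From (2.27) we obtain for `x ∈ ker D_i`
`g_i(x) = h_i(x) + D′_{i−1}(A_i x)`. Thus we have LEMMA 2.9. Given a homotopy operator, then the induced maps
coincide on homology, `g_* = h_*`. We also have `ĝ = ĥ`. … Thus (2.28) and (2.29) simply mean that
`j_* ∘ k_* = id`, `k_* ∘ j_* = id`. … LEMMA 2.10. … Then `h_*` induces an isomorphism …"

Here one degree is the short complex `0 → E →T F →S G → 0` mapped to `0 → E′ →T′ F′ →S′ G′ → 0` (and on to a
third complex `E″, F″, G″` for functoriality); `ker D_i = Ker S`, `ℛ_{i−1} = Im T`, `𝓗̂_i = 𝔥 = Ker S ∩ Ker T*`,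
`s(Δ^{(2)}) ∩ H_i = (ker D_i)^⊥ = (Ker S)^⊥`; a homotopy in the middle degree reads `g_F − h_F = T′A_F + A_G S` on
`D(S)`, in degree `0` it reads `g_E − h_E = A_F T` on `D(T)`, in degree `2` it reads `g_G − h_G = S′A_G` on `G`.
The unitary clause is proved in the form that is used for Poincaré duality (Lemma 2.16): if `g_F` preserves inner
products and carries `Ker S` onto `Ker S′` and `cl Im T` onto `cl Im T′` (as a unitary complex isomorphism does),
then `g_F(𝔥) = 𝔥′` and `ĝ = g_F|𝔥`.

## What is proved (all over `𝕜 = ℝ` or `ℂ`)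

* §1 maps ((2.7)): `apply_mem_pmapKer_of_map`, `apply_mem_range_of_map`, `apply_mem_closure_range_of_map`
  (`g_F` carries `Ker S`, `Im T`, `cl Im T` into `Ker S′`, `Im T′`, `cl Im T′`), `map_pmapKer_le_of_map`,
  `map_range_le_of_map`, `map_closure_range_le_of_map`, `map_comp` / `map_id` (composites and identities are maps).
* §2 the induced map on cohomology: **`exists_cohomologyMap`** (`g_* : Ker S / Im T → Ker S′ / Im T′`,
  `g_*[u] = [g_F u]`), `cohomologyMap_unique`, **`cohomologyMap_comp`** (`(h ∘ g)_* = h_* ∘ g_*`), `cohomologyMap_id`;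
  the same for the reduced cohomology `Ker S / cl Im T`: **`exists_reducedCohomologyMap`**,
  `reducedCohomologyMap_unique`, `reducedCohomologyMap_comp`, `reducedCohomologyMap_id`; and in the top degree
  `G / Im S`: `exists_quotientRangeMap`, `quotientRangeMap_comp`.
* §3 Lemma 2.7, the induced map `ĝ = P_{𝔥′} ∘ g_F` on harmonic spaces: `sub_starProjection_harmonic_mem_closure_range`
  (`x − P_𝔥 x ∈ cl Im T` for `x ∈ Ker S`), `starProjection_harmonic_eq_zero_of_mem_closure_range`,
  **`harmonicMap_comp`** (`(h ∘ g)^ = ĥ ∘ ĝ`), `harmonicMap_id`, **`mkQ_inclusion_harmonicMap`** (`ĝ` is `ḡ_*`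
  under the Hodge isomorphisms `𝔥 ≅ Ker S / cl Im T`); the coexact parts: `coexactMap_comp`, `coexactMap_id`
  (`g² = P_{(Ker S′)^⊥} ∘ g_F` on `(Ker S)^⊥` is functorial); the unitary clause: `map_inf_orthogonal_eq_of_inner_map`,
  **`map_harmonic_eq_of_inner_map`** (`g_F(𝔥) = 𝔥′`), `harmonicMap_apply_eq_of_inner_map` (`ĝ = g_F` on `𝔥`),
  `norm_harmonicMap_eq_of_inner_map`.
* §4 Definition 2.8 / Lemma 2.9, homotopies: `sub_mem_range_of_homotopy` (`g_F u − h_F u ∈ Im T′` on `Ker S`),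
  **`cohomologyMap_eq_of_homotopy`** (`g_* = h_*`), `reducedCohomologyMap_eq_of_homotopy`,
  **`harmonicMap_eq_of_homotopy`** (`ĝ = ĥ`), and the two ends `apply_eq_of_homotopy_of_mem_pmapKer` (degree `0`),
  `sub_mem_range_of_homotopy_top` / `quotientRangeMap_eq_of_homotopy` (degree `2`).
* §5 Lemma 2.10's mechanism: **`cohomologyMap_comp_eq_id_of_homotopy`** (`k ∘ g ≃ id ⇒ k_* ∘ g_* = id`) and
  **`cohomologyMap_bijective_of_homotopyEquiv`** (a homotopy equivalence induces an isomorphism on cohomology).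

## References

* [BruningLesch1992] J. Brüning, M. Lesch, *Hilbert complexes*, J. Funct. Anal. 108 (1992) 88–132, §2 (2.7a)–(2.7b),
  Lemma 2.7, Definition 2.8 (2.26)–(2.27), Lemma 2.9, Lemma 2.10 with (2.28)–(2.29).
* [Gilkey1995] P. B. Gilkey, *Invariance theory, the heat equation, and the Atiyah–Singer index theorem* (1995), §1.8
  p. 62 ("Since `dT* = T*d`, `T*` induces a map on `Hᵖ(M, C)`"; the endomorphism case, row g33-#5).
* [ArnoldFalkWinther2010] D. N. Arnold, R. S. Falk, R. Winther, *Finite element exterior calculus: from Hodge theory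
  to numerical stability*, Bull. AMS 47 (2010), §3.1.3–§3.1.4 (harmonic forms `𝔥 = 𝔷 ∩ 𝔅^⊥`, cochain maps), through
  `HilbertComplexHarmonicCohomology.lean`.
* [DemaillyAGBook] J.-P. Demailly, *Complex Analytic and Differential Geometry*, Ch. VIII §1 Thm 1.2 (`Ker S =
  (Ker S ∩ Ker T*) ⊕ cl Im T`, through `ClosedDenselyDefinedHilbertComplex.lean`).
-/

noncomputable section

open scoped InnerProductSpace LinearPMap

namespace Literature.Analysis.InnerProduct

variable {𝕜 E F G E' F' G' E'' F'' G'' : Type*} [RCLike 𝕜]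
variable [NormedAddCommGroup E] [InnerProductSpace 𝕜 E]
variable [NormedAddCommGroup F] [InnerProductSpace 𝕜 F]
variable [NormedAddCommGroup G] [InnerProductSpace 𝕜 G]
variable [NormedAddCommGroup E'] [InnerProductSpace 𝕜 E']
variable [NormedAddCommGroup F'] [InnerProductSpace 𝕜 F']
variable [NormedAddCommGroup G'] [InnerProductSpace 𝕜 G']
variable [NormedAddCommGroup E''] [InnerProductSpace 𝕜 E'']
variable [NormedAddCommGroup F''] [InnerProductSpace 𝕜 F'']
variable [NormedAddCommGroup G''] [InnerProductSpace 𝕜 G'']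

variable {T : E →ₗ.[𝕜] F} {S : F →ₗ.[𝕜] G} {T' : E' →ₗ.[𝕜] F'} {S' : F' →ₗ.[𝕜] G'}
  {T'' : E'' →ₗ.[𝕜] F''} {S'' : F'' →ₗ.[𝕜] G''}
variable {g_E : E →L[𝕜] E'} {g_F : F →L[𝕜] F'} {g_G : G →L[𝕜] G'}
  {h_E : E' →L[𝕜] E''} {h_F : F' →L[𝕜] F''} {h_G : G' →L[𝕜] G''}

/-! ### §1 Maps of Hilbert complexes ((2.7a)–(2.7b)): cocycles, boundaries and their closures are preserved -/

/-- **A map of complexes carries `Ker S` into `Ker S′`** (`S′(g_F u) = g_G(Su) = 0`; "`g_i` maps `ker D_i` to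
`ker D′_i`"). [cite: BruningLesch1992, §2 (2.7a)–(2.7b), Lemma 2.7 (proof)] -/
theorem apply_mem_pmapKer_of_map
    (hgS : ∀ (u : F) (hu : u ∈ S.domain), ∃ h : g_F u ∈ S'.domain, S' ⟨g_F u, h⟩ = g_G (S ⟨u, hu⟩))
    {u : F} (hu : u ∈ (LinearMap.ker S.toFun).map S.domain.subtype) :
    g_F u ∈ (LinearMap.ker S'.toFun).map S'.domain.subtype := by
  obtain ⟨huS, hSu⟩ := mem_pmapKer_iff.1 hu
  obtain ⟨hgu, hSgu⟩ := hgS u huS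
  exact mem_pmapKer_iff.2 ⟨hgu, by rw [hSgu, hSu, map_zero]⟩

/-- **A map of complexes carries `Im T` into `Im T′`** (`g_F(Tw) = T′(g_E w)`). [cite: BruningLesch1992, §2
(2.7a)–(2.7b) ("`D′_i ∘ g_i = g_{i+1} ∘ D_i`")] -/
theorem apply_mem_range_of_map
    (hgT : ∀ (w : E) (hw : w ∈ T.domain), ∃ h : g_E w ∈ T'.domain, T' ⟨g_E w, h⟩ = g_F (T ⟨w, hw⟩))
    {y : F} (hy : y ∈ LinearMap.range T.toFun) : g_F y ∈ LinearMap.range T'.toFun := by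
  obtain ⟨w, rfl⟩ := LinearMap.mem_range.1 hy
  obtain ⟨hgw, hTgw⟩ := hgT w w.2
  exact LinearMap.mem_range.2 ⟨⟨g_E w, hgw⟩, hTgw⟩

/-- **A map of complexes carries `cl Im T` into `cl Im T′`** (`g_F` is continuous; "`g_i` maps … `cl ℛ_{i−1}` to
`cl ℛ′_{i−1}`"). [cite: BruningLesch1992, §2 Lemma 2.7 (proof)] -/
theorem apply_mem_closure_range_of_map
    (hgT : ∀ (w : E) (hw : w ∈ T.domain), ∃ h : g_E w ∈ T'.domain, T' ⟨g_E w, h⟩ = g_F (T ⟨w, hw⟩))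
    {y : F} (hy : y ∈ (LinearMap.range T.toFun : Submodule 𝕜 F).topologicalClosure) :
    g_F y ∈ (LinearMap.range T'.toFun : Submodule 𝕜 F').topologicalClosure := by
  rw [← SetLike.mem_coe, Submodule.topologicalClosure_coe] at hy ⊢
  exact map_mem_closure g_F.continuous hy fun x hx ↦ apply_mem_range_of_map hgT hx

/-- `g_F(Ker S) ⊆ Ker S′`, subspace form. [cite: BruningLesch1992, §2 (2.7a)–(2.7b), Lemma 2.7 (proof)] -/
theorem map_pmapKer_le_of_map
    (hgS : ∀ (u : F) (hu : u ∈ S.domain), ∃ h : g_F u ∈ S'.domain, S' ⟨g_F u, h⟩ = g_G (S ⟨u, hu⟩)) :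
    ((LinearMap.ker S.toFun).map S.domain.subtype).map (g_F : F →ₗ[𝕜] F') ≤
      (LinearMap.ker S'.toFun).map S'.domain.subtype := by
  rintro _ ⟨u, hu, rfl⟩
  exact apply_mem_pmapKer_of_map hgS hu

/-- `g_F(Im T) ⊆ Im T′`, subspace form. [cite: BruningLesch1992, §2 (2.7a)–(2.7b)] -/
theorem map_range_le_of_map
    (hgT : ∀ (w : E) (hw : w ∈ T.domain), ∃ h : g_E w ∈ T'.domain, T' ⟨g_E w, h⟩ = g_F (T ⟨w, hw⟩)) :
    (LinearMap.range T.toFun).map (g_F : F →ₗ[𝕜] F') ≤ LinearMap.range T'.toFun := by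
  rintro _ ⟨y, hy, rfl⟩
  exact apply_mem_range_of_map hgT hy

/-- `g_F(cl Im T) ⊆ cl Im T′`, subspace form. [cite: BruningLesch1992, §2 Lemma 2.7 (proof)] -/
theorem map_closure_range_le_of_map
    (hgT : ∀ (w : E) (hw : w ∈ T.domain), ∃ h : g_E w ∈ T'.domain, T' ⟨g_E w, h⟩ = g_F (T ⟨w, hw⟩)) :
    ((LinearMap.range T.toFun : Submodule 𝕜 F).topologicalClosure).map (g_F : F →ₗ[𝕜] F') ≤
      (LinearMap.range T'.toFun : Submodule 𝕜 F').topologicalClosure := by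
  rintro _ ⟨y, hy, rfl⟩
  exact apply_mem_closure_range_of_map hgT hy

/-- **The composite of two maps of complexes is a map of complexes** (one square: `h ∘ g` carries `D(T)` into
`D(T″)` and `T″(h_E g_E w) = h_F g_F (Tw)`). [cite: BruningLesch1992, §2 (2.7a)–(2.7b), Lemma 2.7 ("functorial
homomorphisms … with `h : (𝒟′, D′) → (𝒟″, D″)` a second complex map")] -/
theorem map_comp
    (hgT : ∀ (w : E) (hw : w ∈ T.domain), ∃ h : g_E w ∈ T'.domain, T' ⟨g_E w, h⟩ = g_F (T ⟨w, hw⟩))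
    (hhT : ∀ (w' : E') (hw' : w' ∈ T'.domain), ∃ h : h_E w' ∈ T''.domain, T'' ⟨h_E w', h⟩ = h_F (T' ⟨w', hw'⟩)) :
    ∀ (w : E) (hw : w ∈ T.domain), ∃ h : (h_E.comp g_E) w ∈ T''.domain,
      T'' ⟨(h_E.comp g_E) w, h⟩ = (h_F.comp g_F) (T ⟨w, hw⟩) := by
  intro w hw
  obtain ⟨h1, e1⟩ := hgT w hw
  obtain ⟨h2, e2⟩ := hhT (g_E w) h1
  refine ⟨h2, ?_⟩
  change T'' ⟨h_E (g_E w), h2⟩ = h_F (g_F (T ⟨w, hw⟩))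
  rw [e2, e1]

/-- **The identity is a map of complexes.** [cite: BruningLesch1992, §2 (2.7a)–(2.7b)] -/
theorem map_id : ∀ (w : E) (hw : w ∈ T.domain), ∃ h : (ContinuousLinearMap.id 𝕜 E) w ∈ T.domain,
    T ⟨(ContinuousLinearMap.id 𝕜 E) w, h⟩ = (ContinuousLinearMap.id 𝕜 F) (T ⟨w, hw⟩) :=
  fun _ hw ↦ ⟨hw, rfl⟩

/-! ### §2 The induced map `g_*` on the cohomology `Ker S / Im T`, on the reduced cohomology `Ker S / cl Im T`
and on the top cohomology `G / Im S` -/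

/-- **A map of complexes induces `g_* : Ker S / Im T → Ker S′ / Im T′` with `g_*[u] = [g_F u]`.**
[cite: BruningLesch1992, §2 (2.7) ("The induced map on homology will be denoted by `g_*`"); Gilkey1995, §1.8 p. 62] -/
theorem exists_cohomologyMap
    (hgT : ∀ (w : E) (hw : w ∈ T.domain), ∃ h : g_E w ∈ T'.domain, T' ⟨g_E w, h⟩ = g_F (T ⟨w, hw⟩))
    (hgS : ∀ (u : F) (hu : u ∈ S.domain), ∃ h : g_F u ∈ S'.domain, S' ⟨g_F u, h⟩ = g_G (S ⟨u, hu⟩)) :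
    ∃ gq : (↥((LinearMap.ker S.toFun).map S.domain.subtype) ⧸
        (LinearMap.range T.toFun).comap ((LinearMap.ker S.toFun).map S.domain.subtype).subtype) →ₗ[𝕜]
        (↥((LinearMap.ker S'.toFun).map S'.domain.subtype) ⧸
          (LinearMap.range T'.toFun).comap ((LinearMap.ker S'.toFun).map S'.domain.subtype).subtype),
      ∀ (u : ↥((LinearMap.ker S.toFun).map S.domain.subtype))
        (h : g_F (u : F) ∈ (LinearMap.ker S'.toFun).map S'.domain.subtype),
        gq (((LinearMap.range T.toFun).comap ((LinearMap.ker S.toFun).map S.domain.subtype).subtype).mkQ u) =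
          ((LinearMap.range T'.toFun).comap ((LinearMap.ker S'.toFun).map S'.domain.subtype).subtype).mkQ
            ⟨g_F (u : F), h⟩ := by
  let f : ↥((LinearMap.ker S.toFun).map S.domain.subtype) →ₗ[𝕜] ↥((LinearMap.ker S'.toFun).map S'.domain.subtype) :=
    LinearMap.codRestrict _ ((g_F : F →ₗ[𝕜] F').comp ((LinearMap.ker S.toFun).map S.domain.subtype).subtype)
      fun u ↦ apply_mem_pmapKer_of_map hgS u.2
  have hf : (LinearMap.range T.toFun).comap ((LinearMap.ker S.toFun).map S.domain.subtype).subtype ≤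
      ((LinearMap.range T'.toFun).comap ((LinearMap.ker S'.toFun).map S'.domain.subtype).subtype).comap f :=
    fun u hu ↦ by
      rw [Submodule.mem_comap, Submodule.mem_comap]
      exact apply_mem_range_of_map hgT (Submodule.mem_comap.1 hu)
  refine ⟨Submodule.mapQ _ _ f hf, fun u h ↦ ?_⟩
  rw [Submodule.mkQ_apply, Submodule.mkQ_apply, Submodule.mapQ_apply]
  rfl

/-- **`g_*` is determined by `g_*[u] = [g_F u]`.** [cite: BruningLesch1992, §2 (2.7)] -/
theorem cohomologyMap_unique
    (hgS : ∀ (u : F) (hu : u ∈ S.domain), ∃ h : g_F u ∈ S'.domain, S' ⟨g_F u, h⟩ = g_G (S ⟨u, hu⟩))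
    {gq₁ gq₂ : (↥((LinearMap.ker S.toFun).map S.domain.subtype) ⧸
        (LinearMap.range T.toFun).comap ((LinearMap.ker S.toFun).map S.domain.subtype).subtype) →ₗ[𝕜]
        (↥((LinearMap.ker S'.toFun).map S'.domain.subtype) ⧸
          (LinearMap.range T'.toFun).comap ((LinearMap.ker S'.toFun).map S'.domain.subtype).subtype)}
    (h₁ : ∀ (u : ↥((LinearMap.ker S.toFun).map S.domain.subtype))
        (h : g_F (u : F) ∈ (LinearMap.ker S'.toFun).map S'.domain.subtype),
        gq₁ (((LinearMap.range T.toFun).comap ((LinearMap.ker S.toFun).map S.domain.subtype).subtype).mkQ u) =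
          ((LinearMap.range T'.toFun).comap ((LinearMap.ker S'.toFun).map S'.domain.subtype).subtype).mkQ
            ⟨g_F (u : F), h⟩)
    (h₂ : ∀ (u : ↥((LinearMap.ker S.toFun).map S.domain.subtype))
        (h : g_F (u : F) ∈ (LinearMap.ker S'.toFun).map S'.domain.subtype),
        gq₂ (((LinearMap.range T.toFun).comap ((LinearMap.ker S.toFun).map S.domain.subtype).subtype).mkQ u) =
          ((LinearMap.range T'.toFun).comap ((LinearMap.ker S'.toFun).map S'.domain.subtype).subtype).mkQ
            ⟨g_F (u : F), h⟩) :
    gq₁ = gq₂ := by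
  refine LinearMap.ext fun q ↦ ?_
  obtain ⟨u, rfl⟩ := Submodule.mkQ_surjective _ q
  rw [h₁ u (apply_mem_pmapKer_of_map hgS u.2), h₂ u (apply_mem_pmapKer_of_map hgS u.2)]

/-- **Functoriality `(h ∘ g)_* = h_* ∘ g_*`.** [cite: BruningLesch1992, §2 Lemma 2.7 ("functorial homomorphisms";
"The assertion concerning `g_{i*}` is obvious from the definition")] -/
theorem cohomologyMap_comp
    (hgS : ∀ (u : F) (hu : u ∈ S.domain), ∃ h : g_F u ∈ S'.domain, S' ⟨g_F u, h⟩ = g_G (S ⟨u, hu⟩))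
    (hhS : ∀ (u' : F') (hu' : u' ∈ S'.domain), ∃ h : h_F u' ∈ S''.domain, S'' ⟨h_F u', h⟩ = h_G (S' ⟨u', hu'⟩))
    {gq : (↥((LinearMap.ker S.toFun).map S.domain.subtype) ⧸
        (LinearMap.range T.toFun).comap ((LinearMap.ker S.toFun).map S.domain.subtype).subtype) →ₗ[𝕜]
        (↥((LinearMap.ker S'.toFun).map S'.domain.subtype) ⧸
          (LinearMap.range T'.toFun).comap ((LinearMap.ker S'.toFun).map S'.domain.subtype).subtype)}
    (hg : ∀ (u : ↥((LinearMap.ker S.toFun).map S.domain.subtype))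
        (h : g_F (u : F) ∈ (LinearMap.ker S'.toFun).map S'.domain.subtype),
        gq (((LinearMap.range T.toFun).comap ((LinearMap.ker S.toFun).map S.domain.subtype).subtype).mkQ u) =
          ((LinearMap.range T'.toFun).comap ((LinearMap.ker S'.toFun).map S'.domain.subtype).subtype).mkQ
            ⟨g_F (u : F), h⟩)
    {hq : (↥((LinearMap.ker S'.toFun).map S'.domain.subtype) ⧸
        (LinearMap.range T'.toFun).comap ((LinearMap.ker S'.toFun).map S'.domain.subtype).subtype) →ₗ[𝕜]
        (↥((LinearMap.ker S''.toFun).map S''.domain.subtype) ⧸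
          (LinearMap.range T''.toFun).comap ((LinearMap.ker S''.toFun).map S''.domain.subtype).subtype)}
    (hh : ∀ (u' : ↥((LinearMap.ker S'.toFun).map S'.domain.subtype))
        (h : h_F (u' : F') ∈ (LinearMap.ker S''.toFun).map S''.domain.subtype),
        hq (((LinearMap.range T'.toFun).comap ((LinearMap.ker S'.toFun).map S'.domain.subtype).subtype).mkQ u') =
          ((LinearMap.range T''.toFun).comap ((LinearMap.ker S''.toFun).map S''.domain.subtype).subtype).mkQ
            ⟨h_F (u' : F'), h⟩)
    {kq : (↥((LinearMap.ker S.toFun).map S.domain.subtype) ⧸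
        (LinearMap.range T.toFun).comap ((LinearMap.ker S.toFun).map S.domain.subtype).subtype) →ₗ[𝕜]
        (↥((LinearMap.ker S''.toFun).map S''.domain.subtype) ⧸
          (LinearMap.range T''.toFun).comap ((LinearMap.ker S''.toFun).map S''.domain.subtype).subtype)}
    (hk : ∀ (u : ↥((LinearMap.ker S.toFun).map S.domain.subtype))
        (h : (h_F.comp g_F) (u : F) ∈ (LinearMap.ker S''.toFun).map S''.domain.subtype),
        kq (((LinearMap.range T.toFun).comap ((LinearMap.ker S.toFun).map S.domain.subtype).subtype).mkQ u) =
          ((LinearMap.range T''.toFun).comap ((LinearMap.ker S''.toFun).map S''.domain.subtype).subtype).mkQ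
            ⟨(h_F.comp g_F) (u : F), h⟩) :
    kq = hq ∘ₗ gq := by
  refine LinearMap.ext fun q ↦ ?_
  obtain ⟨u, rfl⟩ := Submodule.mkQ_surjective _ q
  have h1 := apply_mem_pmapKer_of_map hgS u.2
  have h2 : h_F (g_F (u : F)) ∈ (LinearMap.ker S''.toFun).map S''.domain.subtype := apply_mem_pmapKer_of_map hhS h1
  rw [LinearMap.comp_apply, hg u h1, hh ⟨g_F (u : F), h1⟩ h2, hk u h2]
  rfl

/-- **`(id)_* = id`.** [cite: BruningLesch1992, §2 Lemma 2.7 ("functorial homomorphisms")] -/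
theorem cohomologyMap_id
    {gq : (↥((LinearMap.ker S.toFun).map S.domain.subtype) ⧸
        (LinearMap.range T.toFun).comap ((LinearMap.ker S.toFun).map S.domain.subtype).subtype) →ₗ[𝕜]
        (↥((LinearMap.ker S.toFun).map S.domain.subtype) ⧸
          (LinearMap.range T.toFun).comap ((LinearMap.ker S.toFun).map S.domain.subtype).subtype)}
    (hg : ∀ (u : ↥((LinearMap.ker S.toFun).map S.domain.subtype))
        (h : (ContinuousLinearMap.id 𝕜 F) (u : F) ∈ (LinearMap.ker S.toFun).map S.domain.subtype),
        gq (((LinearMap.range T.toFun).comap ((LinearMap.ker S.toFun).map S.domain.subtype).subtype).mkQ u) =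
          ((LinearMap.range T.toFun).comap ((LinearMap.ker S.toFun).map S.domain.subtype).subtype).mkQ
            ⟨(ContinuousLinearMap.id 𝕜 F) (u : F), h⟩) :
    gq = LinearMap.id := by
  refine LinearMap.ext fun q ↦ ?_
  obtain ⟨u, rfl⟩ := Submodule.mkQ_surjective _ q
  rw [hg u u.2]
  rfl

/-- **The induced map on the reduced cohomology, `ḡ_* : Ker S / cl Im T → Ker S′ / cl Im T′`, `ḡ_*[u] = [g_F u]`.**
[cite: BruningLesch1992, §2 (2.7), Lemma 2.7 (proof: "`g_i` maps `ker D_i` to `ker D′_i` and `cl ℛ_{i−1}` to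
`cl ℛ′_{i−1}`")] -/
theorem exists_reducedCohomologyMap
    (hgT : ∀ (w : E) (hw : w ∈ T.domain), ∃ h : g_E w ∈ T'.domain, T' ⟨g_E w, h⟩ = g_F (T ⟨w, hw⟩))
    (hgS : ∀ (u : F) (hu : u ∈ S.domain), ∃ h : g_F u ∈ S'.domain, S' ⟨g_F u, h⟩ = g_G (S ⟨u, hu⟩)) :
    ∃ gq : (↥((LinearMap.ker S.toFun).map S.domain.subtype) ⧸
        ((LinearMap.range T.toFun).topologicalClosure).comap
          ((LinearMap.ker S.toFun).map S.domain.subtype).subtype) →ₗ[𝕜]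
        (↥((LinearMap.ker S'.toFun).map S'.domain.subtype) ⧸
          ((LinearMap.range T'.toFun).topologicalClosure).comap
            ((LinearMap.ker S'.toFun).map S'.domain.subtype).subtype),
      ∀ (u : ↥((LinearMap.ker S.toFun).map S.domain.subtype))
        (h : g_F (u : F) ∈ (LinearMap.ker S'.toFun).map S'.domain.subtype),
        gq ((((LinearMap.range T.toFun).topologicalClosure).comap
            ((LinearMap.ker S.toFun).map S.domain.subtype).subtype).mkQ u) =
          (((LinearMap.range T'.toFun).topologicalClosure).comap
            ((LinearMap.ker S'.toFun).map S'.domain.subtype).subtype).mkQ ⟨g_F (u : F), h⟩ := by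
  let f : ↥((LinearMap.ker S.toFun).map S.domain.subtype) →ₗ[𝕜] ↥((LinearMap.ker S'.toFun).map S'.domain.subtype) :=
    LinearMap.codRestrict _ ((g_F : F →ₗ[𝕜] F').comp ((LinearMap.ker S.toFun).map S.domain.subtype).subtype)
      fun u ↦ apply_mem_pmapKer_of_map hgS u.2
  have hf : ((LinearMap.range T.toFun).topologicalClosure).comap
      ((LinearMap.ker S.toFun).map S.domain.subtype).subtype ≤
      (((LinearMap.range T'.toFun).topologicalClosure).comap
        ((LinearMap.ker S'.toFun).map S'.domain.subtype).subtype).comap f :=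
    fun u hu ↦ by
      rw [Submodule.mem_comap, Submodule.mem_comap]
      exact apply_mem_closure_range_of_map hgT (Submodule.mem_comap.1 hu)
  refine ⟨Submodule.mapQ _ _ f hf, fun u h ↦ ?_⟩
  rw [Submodule.mkQ_apply, Submodule.mkQ_apply, Submodule.mapQ_apply]
  rfl

/-- `ḡ_*` is determined by `ḡ_*[u] = [g_F u]`. [cite: BruningLesch1992, §2 (2.7), Lemma 2.7] -/
theorem reducedCohomologyMap_unique
    (hgS : ∀ (u : F) (hu : u ∈ S.domain), ∃ h : g_F u ∈ S'.domain, S' ⟨g_F u, h⟩ = g_G (S ⟨u, hu⟩))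
    {gq₁ gq₂ : (↥((LinearMap.ker S.toFun).map S.domain.subtype) ⧸
        ((LinearMap.range T.toFun).topologicalClosure).comap
          ((LinearMap.ker S.toFun).map S.domain.subtype).subtype) →ₗ[𝕜]
        (↥((LinearMap.ker S'.toFun).map S'.domain.subtype) ⧸
          ((LinearMap.range T'.toFun).topologicalClosure).comap
            ((LinearMap.ker S'.toFun).map S'.domain.subtype).subtype)}
    (h₁ : ∀ (u : ↥((LinearMap.ker S.toFun).map S.domain.subtype))
        (h : g_F (u : F) ∈ (LinearMap.ker S'.toFun).map S'.domain.subtype),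
        gq₁ ((((LinearMap.range T.toFun).topologicalClosure).comap
            ((LinearMap.ker S.toFun).map S.domain.subtype).subtype).mkQ u) =
          (((LinearMap.range T'.toFun).topologicalClosure).comap
            ((LinearMap.ker S'.toFun).map S'.domain.subtype).subtype).mkQ ⟨g_F (u : F), h⟩)
    (h₂ : ∀ (u : ↥((LinearMap.ker S.toFun).map S.domain.subtype))
        (h : g_F (u : F) ∈ (LinearMap.ker S'.toFun).map S'.domain.subtype),
        gq₂ ((((LinearMap.range T.toFun).topologicalClosure).comap
            ((LinearMap.ker S.toFun).map S.domain.subtype).subtype).mkQ u) =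
          (((LinearMap.range T'.toFun).topologicalClosure).comap
            ((LinearMap.ker S'.toFun).map S'.domain.subtype).subtype).mkQ ⟨g_F (u : F), h⟩) :
    gq₁ = gq₂ := by
  refine LinearMap.ext fun q ↦ ?_
  obtain ⟨u, rfl⟩ := Submodule.mkQ_surjective _ q
  rw [h₁ u (apply_mem_pmapKer_of_map hgS u.2), h₂ u (apply_mem_pmapKer_of_map hgS u.2)]

/-- **Functoriality `(h ∘ g)‾_* = h̄_* ∘ ḡ_*` on the reduced cohomology.** [cite: BruningLesch1992, §2 Lemma 2.7] -/
theorem reducedCohomologyMap_comp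
    (hgS : ∀ (u : F) (hu : u ∈ S.domain), ∃ h : g_F u ∈ S'.domain, S' ⟨g_F u, h⟩ = g_G (S ⟨u, hu⟩))
    (hhS : ∀ (u' : F') (hu' : u' ∈ S'.domain), ∃ h : h_F u' ∈ S''.domain, S'' ⟨h_F u', h⟩ = h_G (S' ⟨u', hu'⟩))
    {gq : (↥((LinearMap.ker S.toFun).map S.domain.subtype) ⧸
        ((LinearMap.range T.toFun).topologicalClosure).comap
          ((LinearMap.ker S.toFun).map S.domain.subtype).subtype) →ₗ[𝕜]
        (↥((LinearMap.ker S'.toFun).map S'.domain.subtype) ⧸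
          ((LinearMap.range T'.toFun).topologicalClosure).comap
            ((LinearMap.ker S'.toFun).map S'.domain.subtype).subtype)}
    (hg : ∀ (u : ↥((LinearMap.ker S.toFun).map S.domain.subtype))
        (h : g_F (u : F) ∈ (LinearMap.ker S'.toFun).map S'.domain.subtype),
        gq ((((LinearMap.range T.toFun).topologicalClosure).comap
            ((LinearMap.ker S.toFun).map S.domain.subtype).subtype).mkQ u) =
          (((LinearMap.range T'.toFun).topologicalClosure).comap
            ((LinearMap.ker S'.toFun).map S'.domain.subtype).subtype).mkQ ⟨g_F (u : F), h⟩)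
    {hq : (↥((LinearMap.ker S'.toFun).map S'.domain.subtype) ⧸
        ((LinearMap.range T'.toFun).topologicalClosure).comap
          ((LinearMap.ker S'.toFun).map S'.domain.subtype).subtype) →ₗ[𝕜]
        (↥((LinearMap.ker S''.toFun).map S''.domain.subtype) ⧸
          ((LinearMap.range T''.toFun).topologicalClosure).comap
            ((LinearMap.ker S''.toFun).map S''.domain.subtype).subtype)}
    (hh : ∀ (u' : ↥((LinearMap.ker S'.toFun).map S'.domain.subtype))
        (h : h_F (u' : F') ∈ (LinearMap.ker S''.toFun).map S''.domain.subtype),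
        hq ((((LinearMap.range T'.toFun).topologicalClosure).comap
            ((LinearMap.ker S'.toFun).map S'.domain.subtype).subtype).mkQ u') =
          (((LinearMap.range T''.toFun).topologicalClosure).comap
            ((LinearMap.ker S''.toFun).map S''.domain.subtype).subtype).mkQ ⟨h_F (u' : F'), h⟩)
    {kq : (↥((LinearMap.ker S.toFun).map S.domain.subtype) ⧸
        ((LinearMap.range T.toFun).topologicalClosure).comap
          ((LinearMap.ker S.toFun).map S.domain.subtype).subtype) →ₗ[𝕜]
        (↥((LinearMap.ker S''.toFun).map S''.domain.subtype) ⧸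
          ((LinearMap.range T''.toFun).topologicalClosure).comap
            ((LinearMap.ker S''.toFun).map S''.domain.subtype).subtype)}
    (hk : ∀ (u : ↥((LinearMap.ker S.toFun).map S.domain.subtype))
        (h : (h_F.comp g_F) (u : F) ∈ (LinearMap.ker S''.toFun).map S''.domain.subtype),
        kq ((((LinearMap.range T.toFun).topologicalClosure).comap
            ((LinearMap.ker S.toFun).map S.domain.subtype).subtype).mkQ u) =
          (((LinearMap.range T''.toFun).topologicalClosure).comap
            ((LinearMap.ker S''.toFun).map S''.domain.subtype).subtype).mkQ ⟨(h_F.comp g_F) (u : F), h⟩) :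
    kq = hq ∘ₗ gq := by
  refine LinearMap.ext fun q ↦ ?_
  obtain ⟨u, rfl⟩ := Submodule.mkQ_surjective _ q
  have h1 := apply_mem_pmapKer_of_map hgS u.2
  have h2 : h_F (g_F (u : F)) ∈ (LinearMap.ker S''.toFun).map S''.domain.subtype := apply_mem_pmapKer_of_map hhS h1
  rw [LinearMap.comp_apply, hg u h1, hh ⟨g_F (u : F), h1⟩ h2, hk u h2]
  rfl

/-- `(id)‾_* = id` on the reduced cohomology. [cite: BruningLesch1992, §2 Lemma 2.7] -/
theorem reducedCohomologyMap_id
    {gq : (↥((LinearMap.ker S.toFun).map S.domain.subtype) ⧸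
        ((LinearMap.range T.toFun).topologicalClosure).comap
          ((LinearMap.ker S.toFun).map S.domain.subtype).subtype) →ₗ[𝕜]
        (↥((LinearMap.ker S.toFun).map S.domain.subtype) ⧸
          ((LinearMap.range T.toFun).topologicalClosure).comap
            ((LinearMap.ker S.toFun).map S.domain.subtype).subtype)}
    (hg : ∀ (u : ↥((LinearMap.ker S.toFun).map S.domain.subtype))
        (h : (ContinuousLinearMap.id 𝕜 F) (u : F) ∈ (LinearMap.ker S.toFun).map S.domain.subtype),
        gq ((((LinearMap.range T.toFun).topologicalClosure).comap
            ((LinearMap.ker S.toFun).map S.domain.subtype).subtype).mkQ u) =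
          (((LinearMap.range T.toFun).topologicalClosure).comap
            ((LinearMap.ker S.toFun).map S.domain.subtype).subtype).mkQ ⟨(ContinuousLinearMap.id 𝕜 F) (u : F), h⟩) :
    gq = LinearMap.id := by
  refine LinearMap.ext fun q ↦ ?_
  obtain ⟨u, rfl⟩ := Submodule.mkQ_surjective _ q
  rw [hg u u.2]
  rfl

/-- **The induced map on the top cohomology `G / Im S → G′ / Im S′`, `[y] ↦ [g_G y]`** (a map of complexes
carries `Im S` into `Im S′`). [cite: BruningLesch1992, §2 (2.7) (`g_*` in the last degree)] -/
theorem exists_quotientRangeMap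
    (hgS : ∀ (u : F) (hu : u ∈ S.domain), ∃ h : g_F u ∈ S'.domain, S' ⟨g_F u, h⟩ = g_G (S ⟨u, hu⟩)) :
    ∃ gq : (G ⧸ LinearMap.range S.toFun) →ₗ[𝕜] (G' ⧸ LinearMap.range S'.toFun),
      ∀ y : G, gq ((LinearMap.range S.toFun).mkQ y) = (LinearMap.range S'.toFun).mkQ (g_G y) :=
  ⟨Submodule.mapQ _ _ (g_G : G →ₗ[𝕜] G') (fun _ hy ↦ apply_mem_range_of_map hgS hy), fun _ ↦ rfl⟩

/-- Functoriality on the top cohomology: `(h ∘ g)_* = h_* ∘ g_*` on `G / Im S`. [cite: BruningLesch1992, §2 Lemma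
2.7 ("The assertion concerning `g_{i*}` is obvious from the definition")] -/
theorem quotientRangeMap_comp
    {gq : (G ⧸ LinearMap.range S.toFun) →ₗ[𝕜] (G' ⧸ LinearMap.range S'.toFun)}
    (hg : ∀ y : G, gq ((LinearMap.range S.toFun).mkQ y) = (LinearMap.range S'.toFun).mkQ (g_G y))
    {hq : (G' ⧸ LinearMap.range S'.toFun) →ₗ[𝕜] (G'' ⧸ LinearMap.range S''.toFun)}
    (hh : ∀ y' : G', hq ((LinearMap.range S'.toFun).mkQ y') = (LinearMap.range S''.toFun).mkQ (h_G y'))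
    {kq : (G ⧸ LinearMap.range S.toFun) →ₗ[𝕜] (G'' ⧸ LinearMap.range S''.toFun)}
    (hk : ∀ y : G, kq ((LinearMap.range S.toFun).mkQ y) = (LinearMap.range S''.toFun).mkQ ((h_G.comp g_G) y)) :
    kq = hq ∘ₗ gq := by
  refine LinearMap.ext fun q ↦ ?_
  obtain ⟨y, rfl⟩ := Submodule.mkQ_surjective _ q
  rw [LinearMap.comp_apply, hg, hh, hk]
  rfl

/-! ### §3 Lemma 2.7: the induced map `ĝ = P_{𝔥′} ∘ g_F : 𝔥 → 𝔥′` on harmonic spaces is functorial and is `ḡ_*`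
under the Hodge isomorphism; the coexact parts; the unitary clause -/

/-- **`x − P_𝔥 x ∈ cl Im T` for `x ∈ Ker S`**: the harmonic projection of a cocycle differs from it by a limit of
boundaries (`Ker S = 𝔥 ⊕ cl Im T`, `Ker S ∩ 𝔥^⊥ = cl Im T`). [cite: BruningLesch1992, §2 Lemma 2.1 (2.9)–(2.10) with
(2.8a); DemaillyAGBook, Ch. VIII §1 Thm 1.2 (1.5)] -/
theorem sub_starProjection_harmonic_mem_closure_range [CompleteSpace E] [CompleteSpace F]
    (hdT : Dense (T.domain : Set E))
    (hcS : S.IsClosed) (hST : LinearMap.range T.toFun ≤ (LinearMap.ker S.toFun).map S.domain.subtype)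
    [((LinearMap.ker S.toFun).map S.domain.subtype ⊓
      (LinearMap.ker T†.toFun).map T†.domain.subtype).HasOrthogonalProjection]
    {x : F} (hx : x ∈ (LinearMap.ker S.toFun).map S.domain.subtype) :
    x - ((LinearMap.ker S.toFun).map S.domain.subtype ⊓
        (LinearMap.ker T†.toFun).map T†.domain.subtype).starProjection x ∈
      (LinearMap.range T.toFun).topologicalClosure := by
  have hmem : x - ((LinearMap.ker S.toFun).map S.domain.subtype ⊓
      (LinearMap.ker T†.toFun).map T†.domain.subtype).starProjection x ∈
      (LinearMap.ker S.toFun).map S.domain.subtype ⊓ ((LinearMap.ker S.toFun).map S.domain.subtype ⊓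
        (LinearMap.ker T†.toFun).map T†.domain.subtype)ᗮ :=
    ⟨Submodule.sub_mem _ hx (Submodule.mem_inf.1 (Submodule.starProjection_apply_mem _ x)).1,
      Submodule.sub_starProjection_mem_orthogonal x⟩
  rwa [pmapKer_inf_orthogonal_harmonic_eq_closure_range hdT hcS hST] at hmem

/-- **`P_𝔥` vanishes on `cl Im T`** (`cl Im T ⊥ 𝔥`). [cite: BruningLesch1992, §2 Lemma 2.1 (2.9) with (2.8a)] -/
theorem starProjection_harmonic_eq_zero_of_mem_closure_range [CompleteSpace E] (hdT : Dense (T.domain : Set E))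
    [((LinearMap.ker S.toFun).map S.domain.subtype ⊓
      (LinearMap.ker T†.toFun).map T†.domain.subtype).HasOrthogonalProjection]
    {y : F} (hy : y ∈ (LinearMap.range T.toFun).topologicalClosure) :
    ((LinearMap.ker S.toFun).map S.domain.subtype ⊓
      (LinearMap.ker T†.toFun).map T†.domain.subtype).starProjection y = 0 :=
  (Submodule.starProjection_apply_eq_zero_iff _).2 ((isOrtho_inf_closure_range hdT).symm.le hy)

/-- **Lemma 2.7, functoriality of `ĝ`: `(h ∘ g)^ = ĥ ∘ ĝ`**, where `ĝ = P_{𝔥′} ∘ g_F|𝔥 : 𝔥 → 𝔥′` ("this is an easy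
consequence of the fact that `g_i` maps `ker D_i` to `ker D′_i` and `cl ℛ_{i−1}` to `cl ℛ′_{i−1}`": for `x ∈ 𝔥`,
`g_F x − P_{𝔥′} g_F x ∈ cl Im T′` is carried by `h_F` into `cl Im T″ ⊥ 𝔥″`). [cite: BruningLesch1992, §2 Lemma 2.7] -/
theorem harmonicMap_comp [CompleteSpace E] [CompleteSpace E'] [CompleteSpace F'] [CompleteSpace E'']
    (hdT' : Dense (T'.domain : Set E')) (hcS' : S'.IsClosed)
    (hST' : LinearMap.range T'.toFun ≤ (LinearMap.ker S'.toFun).map S'.domain.subtype)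
    (hdT'' : Dense (T''.domain : Set E''))
    (hgS : ∀ (u : F) (hu : u ∈ S.domain), ∃ h : g_F u ∈ S'.domain, S' ⟨g_F u, h⟩ = g_G (S ⟨u, hu⟩))
    (hhT : ∀ (w' : E') (hw' : w' ∈ T'.domain), ∃ h : h_E w' ∈ T''.domain, T'' ⟨h_E w', h⟩ = h_F (T' ⟨w', hw'⟩))
    [((LinearMap.ker S'.toFun).map S'.domain.subtype ⊓
      (LinearMap.ker T'†.toFun).map T'†.domain.subtype).HasOrthogonalProjection]
    [((LinearMap.ker S''.toFun).map S''.domain.subtype ⊓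
      (LinearMap.ker T''†.toFun).map T''†.domain.subtype).HasOrthogonalProjection] :
    ((LinearMap.ker S''.toFun).map S''.domain.subtype ⊓
        (LinearMap.ker T''†.toFun).map T''†.domain.subtype).orthogonalProjectionOnto.comp
      ((h_F.comp g_F).comp ((LinearMap.ker S.toFun).map S.domain.subtype ⊓
        (LinearMap.ker T†.toFun).map T†.domain.subtype).subtypeL) =
    (((LinearMap.ker S''.toFun).map S''.domain.subtype ⊓
        (LinearMap.ker T''†.toFun).map T''†.domain.subtype).orthogonalProjectionOnto.comp
      (h_F.comp ((LinearMap.ker S'.toFun).map S'.domain.subtype ⊓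
        (LinearMap.ker T'†.toFun).map T'†.domain.subtype).subtypeL)).comp
    (((LinearMap.ker S'.toFun).map S'.domain.subtype ⊓
        (LinearMap.ker T'†.toFun).map T'†.domain.subtype).orthogonalProjectionOnto.comp
      (g_F.comp ((LinearMap.ker S.toFun).map S.domain.subtype ⊓
        (LinearMap.ker T†.toFun).map T†.domain.subtype).subtypeL)) := by
  refine ContinuousLinearMap.ext fun x ↦ Subtype.ext ?_
  simp only [ContinuousLinearMap.comp_apply, Submodule.subtypeL_apply, Submodule.coe_orthogonalProjectionOnto_apply]
  have hgx : g_F (x : F) ∈ (LinearMap.ker S'.toFun).map S'.domain.subtype :=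
    apply_mem_pmapKer_of_map hgS (Submodule.mem_inf.1 x.2).1
  have key : ((LinearMap.ker S''.toFun).map S''.domain.subtype ⊓
      (LinearMap.ker T''†.toFun).map T''†.domain.subtype).starProjection
      (h_F (g_F (x : F) - ((LinearMap.ker S'.toFun).map S'.domain.subtype ⊓
        (LinearMap.ker T'†.toFun).map T'†.domain.subtype).starProjection (g_F (x : F)))) = 0 :=
    starProjection_harmonic_eq_zero_of_mem_closure_range hdT''
      (apply_mem_closure_range_of_map hhT (sub_starProjection_harmonic_mem_closure_range hdT' hcS' hST' hgx))
  rw [map_sub, map_sub, sub_eq_zero] at key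
  exact key

/-- **`(id)^ = id`**: `P_𝔥 x = x` for `x ∈ 𝔥`. [cite: BruningLesch1992, §2 Lemma 2.7 ("functorial homomorphisms")] -/
theorem harmonicMap_id [CompleteSpace E]
    [((LinearMap.ker S.toFun).map S.domain.subtype ⊓
      (LinearMap.ker T†.toFun).map T†.domain.subtype).HasOrthogonalProjection] :
    ((LinearMap.ker S.toFun).map S.domain.subtype ⊓
        (LinearMap.ker T†.toFun).map T†.domain.subtype).orthogonalProjectionOnto.comp
      ((ContinuousLinearMap.id 𝕜 F).comp ((LinearMap.ker S.toFun).map S.domain.subtype ⊓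
        (LinearMap.ker T†.toFun).map T†.domain.subtype).subtypeL) =
    ContinuousLinearMap.id 𝕜 _ := by
  refine ContinuousLinearMap.ext fun x ↦ ?_
  simp only [ContinuousLinearMap.comp_apply, Submodule.subtypeL_apply, ContinuousLinearMap.id_apply,
    Submodule.orthogonalProjectionOnto_mem_subspace_eq_self]

/-- **`ĝ` is `ḡ_*` under the Hodge isomorphisms `𝔥 ≅ Ker S / cl Im T`, `𝔥′ ≅ Ker S′ / cl Im T′`**
(`bijective_mkQ_comp_inclusion_harmonic`): `[ĝ x] = ḡ_*[x]` for `x ∈ 𝔥`, because `g_F x − P_{𝔥′} g_F x ∈ cl Im T′`.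
[cite: BruningLesch1992, §2 Lemma 2.7 with (2.18) / Cor 2.5 ("`𝓗̂_i ≅ H_i`"); Bei2014, §1 p. 5] -/
theorem mkQ_inclusion_harmonicMap [CompleteSpace E] [CompleteSpace E'] [CompleteSpace F']
    (hdT' : Dense (T'.domain : Set E'))
    (hcS' : S'.IsClosed) (hST' : LinearMap.range T'.toFun ≤ (LinearMap.ker S'.toFun).map S'.domain.subtype)
    (hgS : ∀ (u : F) (hu : u ∈ S.domain), ∃ h : g_F u ∈ S'.domain, S' ⟨g_F u, h⟩ = g_G (S ⟨u, hu⟩))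
    [((LinearMap.ker S'.toFun).map S'.domain.subtype ⊓
      (LinearMap.ker T'†.toFun).map T'†.domain.subtype).HasOrthogonalProjection]
    {gq : (↥((LinearMap.ker S.toFun).map S.domain.subtype) ⧸
        ((LinearMap.range T.toFun).topologicalClosure).comap
          ((LinearMap.ker S.toFun).map S.domain.subtype).subtype) →ₗ[𝕜]
        (↥((LinearMap.ker S'.toFun).map S'.domain.subtype) ⧸
          ((LinearMap.range T'.toFun).topologicalClosure).comap
            ((LinearMap.ker S'.toFun).map S'.domain.subtype).subtype)}
    (hg : ∀ (u : ↥((LinearMap.ker S.toFun).map S.domain.subtype))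
        (h : g_F (u : F) ∈ (LinearMap.ker S'.toFun).map S'.domain.subtype),
        gq ((((LinearMap.range T.toFun).topologicalClosure).comap
            ((LinearMap.ker S.toFun).map S.domain.subtype).subtype).mkQ u) =
          (((LinearMap.range T'.toFun).topologicalClosure).comap
            ((LinearMap.ker S'.toFun).map S'.domain.subtype).subtype).mkQ ⟨g_F (u : F), h⟩) :
    ((((LinearMap.range T'.toFun).topologicalClosure).comap
          ((LinearMap.ker S'.toFun).map S'.domain.subtype).subtype).mkQ ∘ₗ
        Submodule.inclusion (inf_le_left :
          (LinearMap.ker S'.toFun).map S'.domain.subtype ⊓ (LinearMap.ker T'†.toFun).map T'†.domain.subtype ≤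
            (LinearMap.ker S'.toFun).map S'.domain.subtype)) ∘ₗ
      (((LinearMap.ker S'.toFun).map S'.domain.subtype ⊓
          (LinearMap.ker T'†.toFun).map T'†.domain.subtype).orthogonalProjectionOnto.comp
        (g_F.comp ((LinearMap.ker S.toFun).map S.domain.subtype ⊓
          (LinearMap.ker T†.toFun).map T†.domain.subtype).subtypeL) :
        ↥((LinearMap.ker S.toFun).map S.domain.subtype ⊓ (LinearMap.ker T†.toFun).map T†.domain.subtype) →ₗ[𝕜]
          ↥((LinearMap.ker S'.toFun).map S'.domain.subtype ⊓ (LinearMap.ker T'†.toFun).map T'†.domain.subtype)) =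
    gq ∘ₗ ((((LinearMap.range T.toFun).topologicalClosure).comap
          ((LinearMap.ker S.toFun).map S.domain.subtype).subtype).mkQ ∘ₗ
        Submodule.inclusion (inf_le_left :
          (LinearMap.ker S.toFun).map S.domain.subtype ⊓ (LinearMap.ker T†.toFun).map T†.domain.subtype ≤
            (LinearMap.ker S.toFun).map S.domain.subtype)) := by
  refine LinearMap.ext fun x ↦ ?_
  have hx : (x : F) ∈ (LinearMap.ker S.toFun).map S.domain.subtype := (Submodule.mem_inf.1 x.2).1
  have hgx : g_F (x : F) ∈ (LinearMap.ker S'.toFun).map S'.domain.subtype := apply_mem_pmapKer_of_map hgS hx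
  rw [LinearMap.comp_apply, LinearMap.comp_apply, LinearMap.comp_apply, LinearMap.comp_apply,
    hg (Submodule.inclusion inf_le_left x) hgx]
  refine (Submodule.Quotient.eq _).2 ?_
  rw [Submodule.mem_comap, map_sub, Submodule.subtype_apply, Submodule.subtype_apply, Submodule.coe_inclusion]
  change ((((LinearMap.ker S'.toFun).map S'.domain.subtype ⊓
      (LinearMap.ker T'†.toFun).map T'†.domain.subtype).orthogonalProjectionOnto (g_F (x : F)) : _) : F') -
      g_F (x : F) ∈ (LinearMap.range T'.toFun).topologicalClosure
  rw [Submodule.coe_orthogonalProjectionOnto_apply, ← neg_sub]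
  exact Submodule.neg_mem _ (sub_starProjection_harmonic_mem_closure_range hdT' hcS' hST' hgx)

/-- **The coexact parts, `g² := P_{(Ker S′)^⊥} ∘ g_F : (Ker S)^⊥ → (Ker S′)^⊥`, are functorial: `(h ∘ g)² = h² ∘ g²`**
("The proof for `g_i^j` is very similar": `g_F x − P g_F x ∈ Ker S′` is carried by `h_F` into `Ker S″ ⊥ (Ker S″)^⊥`).
[cite: BruningLesch1992, §2 Lemma 2.7 (`g_i^j := P_i^{(j)} ∘ g_i : s(Δ^{(j)}) ∩ H_i → s(Δ′^{(j)}) ∩ H′_i`, `j = 2`,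
with Lemma 2.2 `s(Δ²) ∩ H_i = (ker D_i)^⊥`)] -/
theorem coexactMap_comp
    (hhS : ∀ (u' : F') (hu' : u' ∈ S'.domain), ∃ h : h_F u' ∈ S''.domain, S'' ⟨h_F u', h⟩ = h_G (S' ⟨u', hu'⟩))
    [((LinearMap.ker S'.toFun).map S'.domain.subtype).HasOrthogonalProjection]
    [((LinearMap.ker S''.toFun).map S''.domain.subtype).HasOrthogonalProjection] :
    ((LinearMap.ker S''.toFun).map S''.domain.subtype)ᗮ.orthogonalProjectionOnto.comp
      ((h_F.comp g_F).comp ((LinearMap.ker S.toFun).map S.domain.subtype)ᗮ.subtypeL) =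
    (((LinearMap.ker S''.toFun).map S''.domain.subtype)ᗮ.orthogonalProjectionOnto.comp
      (h_F.comp ((LinearMap.ker S'.toFun).map S'.domain.subtype)ᗮ.subtypeL)).comp
    (((LinearMap.ker S'.toFun).map S'.domain.subtype)ᗮ.orthogonalProjectionOnto.comp
      (g_F.comp ((LinearMap.ker S.toFun).map S.domain.subtype)ᗮ.subtypeL)) := by
  refine ContinuousLinearMap.ext fun x ↦ Subtype.ext ?_
  simp only [ContinuousLinearMap.comp_apply, Submodule.subtypeL_apply, Submodule.coe_orthogonalProjectionOnto_apply]
  -- `g_F x − P_{(Ker S′)^⊥} g_F x ∈ (Ker S′)^⊥⊥ = Ker S′`, carried by `h_F` into `Ker S″ = ((Ker S″)^⊥)^⊥`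
  have hd : g_F (x : F) - ((LinearMap.ker S'.toFun).map S'.domain.subtype)ᗮ.starProjection (g_F (x : F)) ∈
      ((LinearMap.ker S'.toFun).map S'.domain.subtype)ᗮᗮ :=
    Submodule.sub_starProjection_mem_orthogonal _
  rw [Submodule.orthogonal_orthogonal] at hd
  have key : ((LinearMap.ker S''.toFun).map S''.domain.subtype)ᗮ.starProjection
      (h_F (g_F (x : F) - ((LinearMap.ker S'.toFun).map S'.domain.subtype)ᗮ.starProjection (g_F (x : F)))) = 0 := by
    refine (Submodule.starProjection_apply_eq_zero_iff _).2 ?_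
    rw [Submodule.orthogonal_orthogonal]
    exact apply_mem_pmapKer_of_map hhS hd
  rw [map_sub, map_sub, sub_eq_zero] at key
  exact key

/-- `(id)² = id` on `(Ker S)^⊥`. [cite: BruningLesch1992, §2 Lemma 2.7] -/
theorem coexactMap_id [((LinearMap.ker S.toFun).map S.domain.subtype).HasOrthogonalProjection] :
    ((LinearMap.ker S.toFun).map S.domain.subtype)ᗮ.orthogonalProjectionOnto.comp
      ((ContinuousLinearMap.id 𝕜 F).comp ((LinearMap.ker S.toFun).map S.domain.subtype)ᗮ.subtypeL) =
    ContinuousLinearMap.id 𝕜 _ := by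
  refine ContinuousLinearMap.ext fun x ↦ ?_
  simp only [ContinuousLinearMap.comp_apply, Submodule.subtypeL_apply, ContinuousLinearMap.id_apply,
    Submodule.orthogonalProjectionOnto_mem_subspace_eq_self]

/-- An inner-product preserving map carries `K ∩ R^⊥` onto `g(K) ∩ g(R)^⊥` ("if `g_i` is unitary it respects
orthogonality"). [cite: BruningLesch1992, §2 Lemma 2.7 (proof of the unitary clause)] -/
theorem map_inf_orthogonal_eq_of_inner_map (hiso : ∀ x y : F, ⟪g_F x, g_F y⟫_𝕜 = ⟪x, y⟫_𝕜)
    (K R : Submodule 𝕜 F) :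
    (K ⊓ Rᗮ).map (g_F : F →ₗ[𝕜] F') = K.map (g_F : F →ₗ[𝕜] F') ⊓ (R.map (g_F : F →ₗ[𝕜] F'))ᗮ := by
  refine le_antisymm ?_ ?_
  · rintro _ ⟨x, hx, rfl⟩
    obtain ⟨hxK, hxR⟩ := Submodule.mem_inf.1 hx
    refine Submodule.mem_inf.2 ⟨⟨x, hxK, rfl⟩, (Submodule.mem_orthogonal _ _).2 ?_⟩
    rintro _ ⟨r, hr, rfl⟩
    change ⟪g_F r, g_F x⟫_𝕜 = 0
    rw [hiso]
    exact (Submodule.mem_orthogonal _ _).1 hxR r hr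
  · rintro _ ⟨⟨x, hxK, rfl⟩, hy⟩
    refine ⟨x, Submodule.mem_inf.2 ⟨hxK, (Submodule.mem_orthogonal _ _).2 fun r hr ↦ ?_⟩, rfl⟩
    rw [← hiso]
    exact (Submodule.mem_orthogonal _ _).1 hy (g_F r) ⟨r, hr, rfl⟩

/-- **Lemma 2.7, unitary clause: `g_F(𝔥) = 𝔥′`** when `g_F` preserves inner products and carries `Ker S` onto
`Ker S′` and `cl Im T` onto `cl Im T′` (as the middle component of a unitary isomorphism of complexes does) —
`𝔥 = Ker S ∩ (cl Im T)^⊥`. [cite: BruningLesch1992, §2 Lemma 2.7 ("if `g_i` is unitary it respects orthogonality,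
and `g_i(𝓗̂_i) = 𝓗̂′_i`"), (2.8a), (2.11)] -/
theorem map_harmonic_eq_of_inner_map [CompleteSpace E] [CompleteSpace F] [CompleteSpace E'] [CompleteSpace F']
    (hdT : Dense (T.domain : Set E)) (hdT' : Dense (T'.domain : Set E'))
    (hiso : ∀ x y : F, ⟪g_F x, g_F y⟫_𝕜 = ⟪x, y⟫_𝕜)
    (hK : ((LinearMap.ker S.toFun).map S.domain.subtype).map (g_F : F →ₗ[𝕜] F') =
      (LinearMap.ker S'.toFun).map S'.domain.subtype)
    (hR : ((LinearMap.range T.toFun).topologicalClosure).map (g_F : F →ₗ[𝕜] F') =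
      (LinearMap.range T'.toFun).topologicalClosure) :
    ((LinearMap.ker S.toFun).map S.domain.subtype ⊓ (LinearMap.ker T†.toFun).map T†.domain.subtype).map
        (g_F : F →ₗ[𝕜] F') =
      (LinearMap.ker S'.toFun).map S'.domain.subtype ⊓ (LinearMap.ker T'†.toFun).map T'†.domain.subtype := by
  have h1 : (LinearMap.ker T†.toFun).map T†.domain.subtype = ((LinearMap.range T.toFun).topologicalClosure)ᗮ := by
    rw [← orthogonal_range_eq_ker_adjoint hdT, ← Submodule.orthogonal_orthogonal_eq_closure,
      Submodule.triorthogonal_eq_orthogonal]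
  have h2 : (LinearMap.ker T'†.toFun).map T'†.domain.subtype = ((LinearMap.range T'.toFun).topologicalClosure)ᗮ := by
    rw [← orthogonal_range_eq_ker_adjoint hdT', ← Submodule.orthogonal_orthogonal_eq_closure,
      Submodule.triorthogonal_eq_orthogonal]
  rw [h1, h2, map_inf_orthogonal_eq_of_inner_map hiso, hK, hR]

/-- **… and then `ĝ = g_F` on `𝔥`** (no projection is needed: `g_F x ∈ 𝔥′` for `x ∈ 𝔥`). [cite: BruningLesch1992,
§2 Lemma 2.7 (unitary clause), Lemma 2.16 (2.49)] -/
theorem harmonicMap_apply_eq_of_inner_map [CompleteSpace E] [CompleteSpace F] [CompleteSpace E'] [CompleteSpace F']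
    (hdT : Dense (T.domain : Set E)) (hdT' : Dense (T'.domain : Set E'))
    (hiso : ∀ x y : F, ⟪g_F x, g_F y⟫_𝕜 = ⟪x, y⟫_𝕜)
    (hK : ((LinearMap.ker S.toFun).map S.domain.subtype).map (g_F : F →ₗ[𝕜] F') =
      (LinearMap.ker S'.toFun).map S'.domain.subtype)
    (hR : ((LinearMap.range T.toFun).topologicalClosure).map (g_F : F →ₗ[𝕜] F') =
      (LinearMap.range T'.toFun).topologicalClosure)
    [((LinearMap.ker S'.toFun).map S'.domain.subtype ⊓
      (LinearMap.ker T'†.toFun).map T'†.domain.subtype).HasOrthogonalProjection]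
    (x : ↥((LinearMap.ker S.toFun).map S.domain.subtype ⊓ (LinearMap.ker T†.toFun).map T†.domain.subtype)) :
    ((((LinearMap.ker S'.toFun).map S'.domain.subtype ⊓
          (LinearMap.ker T'†.toFun).map T'†.domain.subtype).orthogonalProjectionOnto.comp
        (g_F.comp ((LinearMap.ker S.toFun).map S.domain.subtype ⊓
          (LinearMap.ker T†.toFun).map T†.domain.subtype).subtypeL) x : _) : F') = g_F (x : F) := by
  rw [ContinuousLinearMap.comp_apply, ContinuousLinearMap.comp_apply, Submodule.subtypeL_apply,
    Submodule.coe_orthogonalProjectionOnto_apply, Submodule.starProjection_eq_self_iff,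
    ← map_harmonic_eq_of_inner_map hdT hdT' hiso hK hR]
  exact ⟨x, x.2, rfl⟩

/-- **… and `ĝ` is isometric: `‖ĝ x‖ = ‖x‖` on `𝔥`** ("If `g_i` is unitary then so are `g_{i*}`, `ĝ_i`").
[cite: BruningLesch1992, §2 Lemma 2.7 (unitary clause)] -/
theorem norm_harmonicMap_eq_of_inner_map [CompleteSpace E] [CompleteSpace F] [CompleteSpace E'] [CompleteSpace F']
    (hdT : Dense (T.domain : Set E)) (hdT' : Dense (T'.domain : Set E'))
    (hiso : ∀ x y : F, ⟪g_F x, g_F y⟫_𝕜 = ⟪x, y⟫_𝕜)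
    (hK : ((LinearMap.ker S.toFun).map S.domain.subtype).map (g_F : F →ₗ[𝕜] F') =
      (LinearMap.ker S'.toFun).map S'.domain.subtype)
    (hR : ((LinearMap.range T.toFun).topologicalClosure).map (g_F : F →ₗ[𝕜] F') =
      (LinearMap.range T'.toFun).topologicalClosure)
    [((LinearMap.ker S'.toFun).map S'.domain.subtype ⊓
      (LinearMap.ker T'†.toFun).map T'†.domain.subtype).HasOrthogonalProjection]
    (x : ↥((LinearMap.ker S.toFun).map S.domain.subtype ⊓ (LinearMap.ker T†.toFun).map T†.domain.subtype)) :
    ‖(((LinearMap.ker S'.toFun).map S'.domain.subtype ⊓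
          (LinearMap.ker T'†.toFun).map T'†.domain.subtype).orthogonalProjectionOnto.comp
        (g_F.comp ((LinearMap.ker S.toFun).map S.domain.subtype ⊓
          (LinearMap.ker T†.toFun).map T†.domain.subtype).subtypeL)) x‖ = ‖x‖ := by
  rw [Submodule.coe_norm, harmonicMap_apply_eq_of_inner_map hdT hdT' hiso hK hR x, Submodule.coe_norm,
    @norm_eq_sqrt_re_inner 𝕜 _ _ _ _ (g_F (x : F)), @norm_eq_sqrt_re_inner 𝕜 _ _ _ _ (x : F), hiso]

/-! ### §4 Definition 2.8 / Lemma 2.9: homotopic maps induce the same maps on `Ker S / Im T`, `Ker S / cl Im T`, `𝔥`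
(and on `Ker T`, `G / Im S`) -/

section Homotopy

variable {h'_E : E →L[𝕜] E'} {h'_F : F →L[𝕜] F'} {h'_G : G →L[𝕜] G'} {A_F : F →ₗ[𝕜] E'} {A_G : G →ₗ[𝕜] F'}

/-- **"From (2.27) we obtain for `x ∈ ker D_i`: `g_i(x) = h_i(x) + D′_{i−1}(A_i x)`"** — with a homotopy operator
`g_F − h_F = T′A_F + A_G S` on `D(S)`, `g_F u − h_F u ∈ Im T′` for every `u ∈ Ker S`. [cite: BruningLesch1992, §2
Definition 2.8 (2.26)–(2.27), Lemma 2.9 (proof)] -/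
theorem sub_mem_range_of_homotopy
    (hhom : ∀ (u : F) (hu : u ∈ S.domain), ∃ hA : A_F u ∈ T'.domain,
      g_F u - h'_F u = T' ⟨A_F u, hA⟩ + A_G (S ⟨u, hu⟩))
    {u : F} (hu : u ∈ (LinearMap.ker S.toFun).map S.domain.subtype) :
    g_F u - h'_F u ∈ LinearMap.range T'.toFun := by
  obtain ⟨huS, hSu⟩ := mem_pmapKer_iff.1 hu
  obtain ⟨hA, e⟩ := hhom u huS
  rw [hSu, map_zero, add_zero] at e
  rw [e]
  exact LinearMap.mem_range_self _ _

/-- **Lemma 2.9: `g_* = h_*` on `Ker S / Im T`** for homotopic maps of complexes. [cite: BruningLesch1992, §2 Lemma 2.9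
("Given a homotopy operator, then the induced maps coincide on homology, `g_* = h_*`")] -/
theorem cohomologyMap_eq_of_homotopy
    (hgS : ∀ (u : F) (hu : u ∈ S.domain), ∃ h : g_F u ∈ S'.domain, S' ⟨g_F u, h⟩ = g_G (S ⟨u, hu⟩))
    (hhS : ∀ (u : F) (hu : u ∈ S.domain), ∃ h : h'_F u ∈ S'.domain, S' ⟨h'_F u, h⟩ = h'_G (S ⟨u, hu⟩))
    (hhom : ∀ (u : F) (hu : u ∈ S.domain), ∃ hA : A_F u ∈ T'.domain,
      g_F u - h'_F u = T' ⟨A_F u, hA⟩ + A_G (S ⟨u, hu⟩))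
    {gq : (↥((LinearMap.ker S.toFun).map S.domain.subtype) ⧸
        (LinearMap.range T.toFun).comap ((LinearMap.ker S.toFun).map S.domain.subtype).subtype) →ₗ[𝕜]
        (↥((LinearMap.ker S'.toFun).map S'.domain.subtype) ⧸
          (LinearMap.range T'.toFun).comap ((LinearMap.ker S'.toFun).map S'.domain.subtype).subtype)}
    (hg : ∀ (u : ↥((LinearMap.ker S.toFun).map S.domain.subtype))
        (h : g_F (u : F) ∈ (LinearMap.ker S'.toFun).map S'.domain.subtype),
        gq (((LinearMap.range T.toFun).comap ((LinearMap.ker S.toFun).map S.domain.subtype).subtype).mkQ u) =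
          ((LinearMap.range T'.toFun).comap ((LinearMap.ker S'.toFun).map S'.domain.subtype).subtype).mkQ
            ⟨g_F (u : F), h⟩)
    {hq : (↥((LinearMap.ker S.toFun).map S.domain.subtype) ⧸
        (LinearMap.range T.toFun).comap ((LinearMap.ker S.toFun).map S.domain.subtype).subtype) →ₗ[𝕜]
        (↥((LinearMap.ker S'.toFun).map S'.domain.subtype) ⧸
          (LinearMap.range T'.toFun).comap ((LinearMap.ker S'.toFun).map S'.domain.subtype).subtype)}
    (hh : ∀ (u : ↥((LinearMap.ker S.toFun).map S.domain.subtype))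
        (h : h'_F (u : F) ∈ (LinearMap.ker S'.toFun).map S'.domain.subtype),
        hq (((LinearMap.range T.toFun).comap ((LinearMap.ker S.toFun).map S.domain.subtype).subtype).mkQ u) =
          ((LinearMap.range T'.toFun).comap ((LinearMap.ker S'.toFun).map S'.domain.subtype).subtype).mkQ
            ⟨h'_F (u : F), h⟩) :
    gq = hq := by
  refine LinearMap.ext fun q ↦ ?_
  obtain ⟨u, rfl⟩ := Submodule.mkQ_surjective _ q
  rw [hg u (apply_mem_pmapKer_of_map hgS u.2), hh u (apply_mem_pmapKer_of_map hhS u.2)]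
  refine (Submodule.Quotient.eq _).2 ?_
  rw [Submodule.mem_comap]
  exact sub_mem_range_of_homotopy hhom u.2

/-- **Lemma 2.9 on the reduced cohomology: `ḡ_* = h̄_*` on `Ker S / cl Im T`.** [cite: BruningLesch1992, §2 Lemma 2.9] -/
theorem reducedCohomologyMap_eq_of_homotopy
    (hgS : ∀ (u : F) (hu : u ∈ S.domain), ∃ h : g_F u ∈ S'.domain, S' ⟨g_F u, h⟩ = g_G (S ⟨u, hu⟩))
    (hhS : ∀ (u : F) (hu : u ∈ S.domain), ∃ h : h'_F u ∈ S'.domain, S' ⟨h'_F u, h⟩ = h'_G (S ⟨u, hu⟩))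
    (hhom : ∀ (u : F) (hu : u ∈ S.domain), ∃ hA : A_F u ∈ T'.domain,
      g_F u - h'_F u = T' ⟨A_F u, hA⟩ + A_G (S ⟨u, hu⟩))
    {gq : (↥((LinearMap.ker S.toFun).map S.domain.subtype) ⧸
        ((LinearMap.range T.toFun).topologicalClosure).comap
          ((LinearMap.ker S.toFun).map S.domain.subtype).subtype) →ₗ[𝕜]
        (↥((LinearMap.ker S'.toFun).map S'.domain.subtype) ⧸
          ((LinearMap.range T'.toFun).topologicalClosure).comap
            ((LinearMap.ker S'.toFun).map S'.domain.subtype).subtype)}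
    (hg : ∀ (u : ↥((LinearMap.ker S.toFun).map S.domain.subtype))
        (h : g_F (u : F) ∈ (LinearMap.ker S'.toFun).map S'.domain.subtype),
        gq ((((LinearMap.range T.toFun).topologicalClosure).comap
            ((LinearMap.ker S.toFun).map S.domain.subtype).subtype).mkQ u) =
          (((LinearMap.range T'.toFun).topologicalClosure).comap
            ((LinearMap.ker S'.toFun).map S'.domain.subtype).subtype).mkQ ⟨g_F (u : F), h⟩)
    {hq : (↥((LinearMap.ker S.toFun).map S.domain.subtype) ⧸
        ((LinearMap.range T.toFun).topologicalClosure).comap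
          ((LinearMap.ker S.toFun).map S.domain.subtype).subtype) →ₗ[𝕜]
        (↥((LinearMap.ker S'.toFun).map S'.domain.subtype) ⧸
          ((LinearMap.range T'.toFun).topologicalClosure).comap
            ((LinearMap.ker S'.toFun).map S'.domain.subtype).subtype)}
    (hh : ∀ (u : ↥((LinearMap.ker S.toFun).map S.domain.subtype))
        (h : h'_F (u : F) ∈ (LinearMap.ker S'.toFun).map S'.domain.subtype),
        hq ((((LinearMap.range T.toFun).topologicalClosure).comap
            ((LinearMap.ker S.toFun).map S.domain.subtype).subtype).mkQ u) =
          (((LinearMap.range T'.toFun).topologicalClosure).comap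
            ((LinearMap.ker S'.toFun).map S'.domain.subtype).subtype).mkQ ⟨h'_F (u : F), h⟩) :
    gq = hq := by
  refine LinearMap.ext fun q ↦ ?_
  obtain ⟨u, rfl⟩ := Submodule.mkQ_surjective _ q
  rw [hg u (apply_mem_pmapKer_of_map hgS u.2), hh u (apply_mem_pmapKer_of_map hhS u.2)]
  refine (Submodule.Quotient.eq _).2 ?_
  rw [Submodule.mem_comap]
  exact Submodule.le_topologicalClosure _ (sub_mem_range_of_homotopy hhom u.2)

/-- **Lemma 2.9: "We also have `ĝ = ĥ`"** — homotopic maps induce the same map `P_{𝔥′} ∘ g_F = P_{𝔥′} ∘ h_F` on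
`𝔥` (`g_F x − h_F x ∈ Im T′ ⊥ 𝔥′`). [cite: BruningLesch1992, §2 Lemma 2.9] -/
theorem harmonicMap_eq_of_homotopy [CompleteSpace E] [CompleteSpace E'] (hdT' : Dense (T'.domain : Set E'))
    (hhom : ∀ (u : F) (hu : u ∈ S.domain), ∃ hA : A_F u ∈ T'.domain,
      g_F u - h'_F u = T' ⟨A_F u, hA⟩ + A_G (S ⟨u, hu⟩))
    [((LinearMap.ker S'.toFun).map S'.domain.subtype ⊓
      (LinearMap.ker T'†.toFun).map T'†.domain.subtype).HasOrthogonalProjection] :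
    ((LinearMap.ker S'.toFun).map S'.domain.subtype ⊓
        (LinearMap.ker T'†.toFun).map T'†.domain.subtype).orthogonalProjectionOnto.comp
      (g_F.comp ((LinearMap.ker S.toFun).map S.domain.subtype ⊓
        (LinearMap.ker T†.toFun).map T†.domain.subtype).subtypeL) =
    ((LinearMap.ker S'.toFun).map S'.domain.subtype ⊓
        (LinearMap.ker T'†.toFun).map T'†.domain.subtype).orthogonalProjectionOnto.comp
      (h'_F.comp ((LinearMap.ker S.toFun).map S.domain.subtype ⊓
        (LinearMap.ker T†.toFun).map T†.domain.subtype).subtypeL) := by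
  refine ContinuousLinearMap.ext fun x ↦ Subtype.ext ?_
  simp only [ContinuousLinearMap.comp_apply, Submodule.subtypeL_apply, Submodule.coe_orthogonalProjectionOnto_apply]
  have key : ((LinearMap.ker S'.toFun).map S'.domain.subtype ⊓
      (LinearMap.ker T'†.toFun).map T'†.domain.subtype).starProjection (g_F (x : F) - h'_F (x : F)) = 0 :=
    starProjection_harmonic_eq_zero_of_mem_closure_range hdT'
      (Submodule.le_topologicalClosure _ (sub_mem_range_of_homotopy hhom (Submodule.mem_inf.1 x.2).1))
  rw [map_sub, sub_eq_zero] at key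
  exact key

/-- **Degree `0`: homotopic maps agree on `Ker T`** (`g_E − h_E = A_F T` on `D(T)`; there is no `D′_{−1}`).
[cite: BruningLesch1992, §2 Definition 2.8 (2.27), Lemma 2.9] -/
theorem apply_eq_of_homotopy_of_mem_pmapKer {A'_F : F →ₗ[𝕜] E'}
    (hhom₀ : ∀ (w : E) (hw : w ∈ T.domain), g_E w - h'_E w = A'_F (T ⟨w, hw⟩))
    {w : E} (hw : w ∈ (LinearMap.ker T.toFun).map T.domain.subtype) : g_E w = h'_E w := by
  obtain ⟨hwT, hTw⟩ := mem_pmapKer_iff.1 hw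
  have e := hhom₀ w hwT
  rw [hTw, map_zero] at e
  exact sub_eq_zero.1 e

/-- **Degree `2`: `g_G y − h_G y ∈ Im S′` for all `y`** (`g_G − h_G = S′A_G` on `G`; there is no `D_2`).
[cite: BruningLesch1992, §2 Definition 2.8 (2.27), Lemma 2.9] -/
theorem sub_mem_range_of_homotopy_top
    (hhom₂ : ∀ y : G, ∃ hA : A_G y ∈ S'.domain, g_G y - h'_G y = S' ⟨A_G y, hA⟩) (y : G) :
    g_G y - h'_G y ∈ LinearMap.range S'.toFun := by
  obtain ⟨hA, e⟩ := hhom₂ y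
  rw [e]
  exact LinearMap.mem_range_self _ _

/-- **Degree `2`: `g_* = h_*` on `G / Im S`** for homotopic maps. [cite: BruningLesch1992, §2 Lemma 2.9] -/
theorem quotientRangeMap_eq_of_homotopy
    (hhom₂ : ∀ y : G, ∃ hA : A_G y ∈ S'.domain, g_G y - h'_G y = S' ⟨A_G y, hA⟩)
    {gq : (G ⧸ LinearMap.range S.toFun) →ₗ[𝕜] (G' ⧸ LinearMap.range S'.toFun)}
    (hg : ∀ y : G, gq ((LinearMap.range S.toFun).mkQ y) = (LinearMap.range S'.toFun).mkQ (g_G y))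
    {hq : (G ⧸ LinearMap.range S.toFun) →ₗ[𝕜] (G' ⧸ LinearMap.range S'.toFun)}
    (hh : ∀ y : G, hq ((LinearMap.range S.toFun).mkQ y) = (LinearMap.range S'.toFun).mkQ (h'_G y)) :
    gq = hq := by
  refine LinearMap.ext fun q ↦ ?_
  obtain ⟨y, rfl⟩ := Submodule.mkQ_surjective _ q
  rw [hg, hh]
  exact (Submodule.Quotient.eq _).2 (sub_mem_range_of_homotopy_top hhom₂ y)

end Homotopy

/-! ### §5 Lemma 2.10: a map with a homotopy inverse induces an isomorphism on cohomology -/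

section HomotopyEquiv

variable {k_E : E' →L[𝕜] E} {k_F : F' →L[𝕜] F} {k_G : G' →L[𝕜] G}
  {A_F : F →ₗ[𝕜] E} {A_G : G →ₗ[𝕜] F} {A'_F : F' →ₗ[𝕜] E'} {A'_G : G' →ₗ[𝕜] F'}

/-- **`k ∘ g ≃ id ⇒ k_* ∘ g_* = id`** on `Ker S / Im T` ("(2.28) and (2.29) simply mean that `j_* ∘ k_* = id`,
`k_* ∘ j_* = id`"). [cite: BruningLesch1992, §2 Lemma 2.9, Lemma 2.10 with (2.28)] -/
theorem cohomologyMap_comp_eq_id_of_homotopy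
    (hgS : ∀ (u : F) (hu : u ∈ S.domain), ∃ h : g_F u ∈ S'.domain, S' ⟨g_F u, h⟩ = g_G (S ⟨u, hu⟩))
    (hkS : ∀ (u' : F') (hu' : u' ∈ S'.domain), ∃ h : k_F u' ∈ S.domain, S ⟨k_F u', h⟩ = k_G (S' ⟨u', hu'⟩))
    (hhom : ∀ (u : F) (hu : u ∈ S.domain), ∃ hA : A_F u ∈ T.domain,
      (k_F.comp g_F) u - u = T ⟨A_F u, hA⟩ + A_G (S ⟨u, hu⟩))
    {gq : (↥((LinearMap.ker S.toFun).map S.domain.subtype) ⧸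
        (LinearMap.range T.toFun).comap ((LinearMap.ker S.toFun).map S.domain.subtype).subtype) →ₗ[𝕜]
        (↥((LinearMap.ker S'.toFun).map S'.domain.subtype) ⧸
          (LinearMap.range T'.toFun).comap ((LinearMap.ker S'.toFun).map S'.domain.subtype).subtype)}
    (hg : ∀ (u : ↥((LinearMap.ker S.toFun).map S.domain.subtype))
        (h : g_F (u : F) ∈ (LinearMap.ker S'.toFun).map S'.domain.subtype),
        gq (((LinearMap.range T.toFun).comap ((LinearMap.ker S.toFun).map S.domain.subtype).subtype).mkQ u) =
          ((LinearMap.range T'.toFun).comap ((LinearMap.ker S'.toFun).map S'.domain.subtype).subtype).mkQ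
            ⟨g_F (u : F), h⟩)
    {kq : (↥((LinearMap.ker S'.toFun).map S'.domain.subtype) ⧸
        (LinearMap.range T'.toFun).comap ((LinearMap.ker S'.toFun).map S'.domain.subtype).subtype) →ₗ[𝕜]
        (↥((LinearMap.ker S.toFun).map S.domain.subtype) ⧸
          (LinearMap.range T.toFun).comap ((LinearMap.ker S.toFun).map S.domain.subtype).subtype)}
    (hk : ∀ (u' : ↥((LinearMap.ker S'.toFun).map S'.domain.subtype))
        (h : k_F (u' : F') ∈ (LinearMap.ker S.toFun).map S.domain.subtype),
        kq (((LinearMap.range T'.toFun).comap ((LinearMap.ker S'.toFun).map S'.domain.subtype).subtype).mkQ u') =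
          ((LinearMap.range T.toFun).comap ((LinearMap.ker S.toFun).map S.domain.subtype).subtype).mkQ
            ⟨k_F (u' : F'), h⟩) :
    kq ∘ₗ gq = LinearMap.id := by
  refine LinearMap.ext fun q ↦ ?_
  obtain ⟨u, rfl⟩ := Submodule.mkQ_surjective _ q
  have h1 := apply_mem_pmapKer_of_map hgS u.2
  have h2 : k_F (g_F (u : F)) ∈ (LinearMap.ker S.toFun).map S.domain.subtype := apply_mem_pmapKer_of_map hkS h1
  rw [LinearMap.comp_apply, hg u h1, hk ⟨g_F (u : F), h1⟩ h2, LinearMap.id_apply]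
  refine (Submodule.Quotient.eq _).2 ?_
  rw [Submodule.mem_comap]
  exact sub_mem_range_of_homotopy (g_F := k_F.comp g_F) (h'_F := ContinuousLinearMap.id 𝕜 F) hhom u.2

/-- **Lemma 2.10 (the mechanism): a homotopy equivalence of Hilbert complexes induces an isomorphism on the
cohomology `Ker S / Im T`** — if `k ∘ g ≃ id` and `g ∘ k ≃ id` by homotopy operators, then `g_*` is bijective with
inverse `k_*`. [cite: BruningLesch1992, §2 Lemma 2.10 ("`h_*` induces an isomorphism"), (2.28)–(2.29)] -/
theorem cohomologyMap_bijective_of_homotopyEquiv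
    (hgS : ∀ (u : F) (hu : u ∈ S.domain), ∃ h : g_F u ∈ S'.domain, S' ⟨g_F u, h⟩ = g_G (S ⟨u, hu⟩))
    (hkS : ∀ (u' : F') (hu' : u' ∈ S'.domain), ∃ h : k_F u' ∈ S.domain, S ⟨k_F u', h⟩ = k_G (S' ⟨u', hu'⟩))
    (hhom : ∀ (u : F) (hu : u ∈ S.domain), ∃ hA : A_F u ∈ T.domain,
      (k_F.comp g_F) u - u = T ⟨A_F u, hA⟩ + A_G (S ⟨u, hu⟩))
    (hhom' : ∀ (u' : F') (hu' : u' ∈ S'.domain), ∃ hA : A'_F u' ∈ T'.domain,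
      (g_F.comp k_F) u' - u' = T' ⟨A'_F u', hA⟩ + A'_G (S' ⟨u', hu'⟩))
    {gq : (↥((LinearMap.ker S.toFun).map S.domain.subtype) ⧸
        (LinearMap.range T.toFun).comap ((LinearMap.ker S.toFun).map S.domain.subtype).subtype) →ₗ[𝕜]
        (↥((LinearMap.ker S'.toFun).map S'.domain.subtype) ⧸
          (LinearMap.range T'.toFun).comap ((LinearMap.ker S'.toFun).map S'.domain.subtype).subtype)}
    (hg : ∀ (u : ↥((LinearMap.ker S.toFun).map S.domain.subtype))
        (h : g_F (u : F) ∈ (LinearMap.ker S'.toFun).map S'.domain.subtype),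
        gq (((LinearMap.range T.toFun).comap ((LinearMap.ker S.toFun).map S.domain.subtype).subtype).mkQ u) =
          ((LinearMap.range T'.toFun).comap ((LinearMap.ker S'.toFun).map S'.domain.subtype).subtype).mkQ
            ⟨g_F (u : F), h⟩)
    {kq : (↥((LinearMap.ker S'.toFun).map S'.domain.subtype) ⧸
        (LinearMap.range T'.toFun).comap ((LinearMap.ker S'.toFun).map S'.domain.subtype).subtype) →ₗ[𝕜]
        (↥((LinearMap.ker S.toFun).map S.domain.subtype) ⧸
          (LinearMap.range T.toFun).comap ((LinearMap.ker S.toFun).map S.domain.subtype).subtype)}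
    (hk : ∀ (u' : ↥((LinearMap.ker S'.toFun).map S'.domain.subtype))
        (h : k_F (u' : F') ∈ (LinearMap.ker S.toFun).map S.domain.subtype),
        kq (((LinearMap.range T'.toFun).comap ((LinearMap.ker S'.toFun).map S'.domain.subtype).subtype).mkQ u') =
          ((LinearMap.range T.toFun).comap ((LinearMap.ker S.toFun).map S.domain.subtype).subtype).mkQ
            ⟨k_F (u' : F'), h⟩) :
    Function.Bijective gq := by
  have h1 := cohomologyMap_comp_eq_id_of_homotopy hgS hkS hhom hg hk
  have h2 := cohomologyMap_comp_eq_id_of_homotopy hkS hgS hhom' hk hg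
  refine Function.bijective_iff_has_inverse.2 ⟨kq, fun q ↦ ?_, fun q' ↦ ?_⟩
  · exact LinearMap.congr_fun h1 q
  · exact LinearMap.congr_fun h2 q'

end HomotopyEquiv

end Literature.Analysis.InnerProduct
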